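import Mathlib
import Summits.Ventures.HodgeRepro2.Defs
import Summits.Ventures.HodgeRepro2.T6A1WeilDescent
import Summits.Ventures.HodgeRepro2.T6A1LineHit

/-!
# T6A1WeilLine — p1's `weilLine` is the range of the Weil projector (Lemma A1.3 ↔ Prop. A2.3(iv))

Tier-6 sub-goal A1 (route/T6-A1-t6-p1.md §1 (A1.ii)–(A1.iv); §3 layer L2). The interface's rational Weil
line `weilQ K` is p1's `weilLine 4 (Fin 4 → K)` (Defs.lean, p386593): the annihilator of the `ℚ`-linear
relations among fourth powers of `K`, i.e. `w ∈ weilLine ↔ ∀ c, ∑ q_a a⁴ = 0 → ∑ q_a [a]^* w = 0`. This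
file identifies it with the range of the Weil projector `p_W = Q([x]^*)` of `T6A1WeilDescent` (hence with
the descended Weil line `W₀`, `W₀ ⊗ F = ⊕_σ ⋀⁴ V_σ`): `⊆` from the relation `Q(x⁴) − 1 = 0` among fourth
powers (`Q(x⁴) = 1` because `p_W` is the identity on the non-zero space `W₀`, read through `restrictMap`),
`⊇` because `[a]^*` acts on `W₀` as `a⁴ •` through `restrictMap` (`T6A1LineHit.restrictMap_T`). With it,
LINE-HIT and the projector statements transfer to `weilLine` verbatim (`weilLine_le_of_inf_ne_bot`).
-/

namespace Summit.Ventures.HodgeRepro2.T6.A1WeilLine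

open Polynomial A1WeilProjector A1WeilDescent A1LineHit
open scoped TensorProduct

section generic

variable (F : Type*) [Field F] [Algebra ℚ F]
variable (V : Type*) [AddCommGroup V] [Module ℚ V] [Module F V] [IsScalarTower ℚ F V]

/-- `[1]^* = 1`. -/
theorem T_one (n : ℕ) : T F V n 1 = 1 := by
  unfold T
  have : ((LinearMap.lsmul F V) 1).restrictScalars ℚ = LinearMap.id := by
    ext v
    simp
  rw [this, exteriorPower.map_id]
  rfl

/-- `[x y]^* = [x]^* [y]^*` (TIER4 (A0.2)). -/
theorem T_mul (n : ℕ) (x y : F) : T F V n (x * y) = T F V n x * T F V n y := by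
  unfold T
  rw [Module.End.mul_eq_comp, ← exteriorPower.map_comp]
  congr 1
  ext v
  simp only [LinearMap.comp_apply, LinearMap.coe_restrictScalars, LinearMap.lsmul_apply, mul_smul]

/-- `[x^j]^* = ([x]^*)^j`. -/
theorem T_pow (n : ℕ) (x : F) (j : ℕ) : T F V n (x ^ j) = T F V n x ^ j := by
  induction j with
  | zero => rw [pow_zero, pow_zero, T_one]
  | succ j ih => rw [pow_succ, pow_succ, T_mul, ih]

/-- `[a]^*` commutes with every polynomial in `[x]^*`. -/
theorem commute_T_aeval (n : ℕ) (a x : F) (Q : ℚ[X]) :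
    Commute (T F V n a) (aeval (T F V n x) Q) := by
  have hc : Commute (T F V n a) (T F V n x) := by
    change T F V n a * T F V n x = T F V n x * T F V n a
    rw [Module.End.mul_eq_comp, Module.End.mul_eq_comp]
    exact T_comm F V n a x
  rw [Polynomial.aeval_eq_sum_range]
  exact Commute.sum_right _ _ _ fun i _ => (hc.pow_right i).smul_right _

/-- The range of a polynomial in `[x]^*` is stable under every `[a]^*`. -/
theorem T_mem_range_aeval (n : ℕ) (a x : F) (Q : ℚ[X]) {w : ⋀[ℚ]^n V}
    (hw : w ∈ LinearMap.range (aeval (T F V n x) Q)) :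
    T F V n a w ∈ LinearMap.range (aeval (T F V n x) Q) := by
  obtain ⟨v, rfl⟩ := hw
  refine ⟨T F V n a v, ?_⟩
  have := congrArg (fun g => g v) (commute_T_aeval F V n a x Q).eq
  simpa only [Module.End.mul_apply] using this.symm

/-- Through p7's restriction map `⋀[ℚ]^n V → ⋀[F]^n V`, a polynomial in `[x]^*` becomes multiplication
by the same polynomial evaluated at `x^n` (Lemma A3.1 step (1), for the whole correspondence algebra). -/
theorem restrictMap_aeval (n : ℕ) (x : F) (Q : ℚ[X]) (v : ⋀[ℚ]^n V) :
    A1DescendedSurjection.restrictMap ℚ F V n (aeval (T F V n x) Q v) =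
      aeval (x ^ n) Q • A1DescendedSurjection.restrictMap ℚ F V n v := by
  rw [Polynomial.aeval_eq_sum_range, Polynomial.aeval_eq_sum_range, LinearMap.sum_apply, map_sum,
    Finset.sum_smul]
  refine Finset.sum_congr rfl fun j _ => ?_
  rw [LinearMap.smul_apply, map_smul, ← T_pow, restrictMap_T, smul_assoc, pow_right_comm]

omit [Algebra ℚ F] in
/-- The finsupp encoding of the relation `∑_j c_j (x^j)⁴ − 1·1⁴` among fourth powers (and of the
corresponding combination of correspondences), evaluated along any function `g`. -/
theorem sum_relation {M : Type*} [AddCommGroup M] [Module ℚ M] (x : F) (Q : ℚ[X]) (g : F → M) :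
    (((∑ j ∈ Finset.range (Q.natDegree + 1), Finsupp.single (x ^ j) (Q.coeff j)) -
        Finsupp.single 1 1).sum fun a q => q • g a) =
      (∑ j ∈ Finset.range (Q.natDegree + 1), Q.coeff j • g (x ^ j)) - g 1 := by
  rw [Finsupp.sum_sub_index (fun a b₁ b₂ => sub_smul b₁ b₂ (g a)),
    ← Finsupp.sum_finsetSum_index (fun a => zero_smul ℚ (g a)) (fun a b₁ b₂ => add_smul b₁ b₂ (g a)),
    Finsupp.sum_single_index (h := fun a q => q • g a) (zero_smul ℚ (g 1)), one_smul]
  refine congrArg (· - g 1) (Finset.sum_congr rfl fun j _ => ?_)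
  rw [Finsupp.sum_single_index (h := fun a q => q • g a) (zero_smul ℚ _)]

end generic

section numberField

variable (F : Type*) [Field F] [NumberField F] [IsGalois ℚ F]
variable (V : Type*) [AddCommGroup V] [Module ℚ V] [Module F V] [IsScalarTower ℚ F V]
  [FiniteDimensional F V]
variable {I : Type*} [LinearOrder I] (b : Module.Basis I ℚ V) [DecidableEq (F →ₐ[ℚ] F)]

/-- `Q(x⁴) = 1` for any `(x, Q)` whose `p_W = Q([x]^*)` is idempotent with the descended Weil line as its
range (the Lagrange polynomial is `1` at the Weil node `x⁴ = χ_{4e_{id}}(x)`; here derived from the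
projector alone: `p_W` is the identity on the non-zero space `W₀`, read through `restrictMap`). -/
theorem aeval_pow_eq_one (hn : Module.finrank F V = 4) (x : F) (Q : ℚ[X])
    (hp : IsIdempotentElem (aeval (T F V 4 x) Q))
    (hW : Submodule.baseChange F (LinearMap.range (aeval (T F V 4 x) Q)) =
      A1SplitSummandDescent.eigenSummandK ℚ F F V 4 b) :
    aeval (x ^ 4) Q = 1 := by
  obtain ⟨W₁, hW₁, hbij⟩ := A1DescendedBijection.exists_descended_bijective ℚ F F V 4 b
    (A1GaloisTensorSplitting.card_algHom_self ℚ F)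
  have hWW : W₁ = LinearMap.range (aeval (T F V 4 x) Q) :=
    A1BaseChange.baseChange_injective (K := F) (hW₁.trans hW.symm)
  -- W₁ is non-zero: its ℚ-dimension is [F : ℚ]
  have hdim : Module.finrank ℚ W₁ = Module.finrank ℚ F := by
    haveI : NeZero (Module.finrank F V) := ⟨by rw [hn]; exact four_ne_zero⟩
    have key : ∀ (m : ℕ) (hm : Module.finrank F V = m) (W : Submodule ℚ (⋀[ℚ]^m V)),
        Submodule.baseChange F W = A1SplitSummandDescent.eigenSummandK ℚ F F V m b →
          Module.finrank ℚ W = Module.finrank ℚ F := by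
      intro m hm W hW'
      subst hm
      exact A1DescendedBijection.finrank_descended_top ℚ F V b W hW'
    exact key 4 hn W₁ hW₁
  have hne : W₁ ≠ ⊥ := by
    intro h
    have h0 : Module.finrank ℚ W₁ = 0 := by rw [h]; exact finrank_bot ℚ _
    rw [hdim] at h0
    exact (Module.finrank_pos (R := ℚ) (M := F)).ne' h0
  obtain ⟨w, hw, hw0⟩ := (Submodule.ne_bot_iff _).1 hne
  set r := A1DescendedSurjection.restrictMap ℚ F V 4 with hr
  have hr0 : r w ≠ 0 := by
    intro h
    have : (r ∘ₗ W₁.subtype) ⟨w, hw⟩ = (r ∘ₗ W₁.subtype) 0 := by simpa using h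
    exact hw0 (congrArg Subtype.val (hbij.1 this))
  -- p_W w = w
  have hpw : aeval (T F V 4 x) Q w = w := by
    rw [hWW] at hw
    obtain ⟨v, rfl⟩ := hw
    exact congrArg (fun g => g v) hp
  have h1 : aeval (x ^ 4) Q • r w = r w := by
    rw [← restrictMap_aeval, hpw]
  exact smul_left_injective F hr0 (h1.trans (one_smul F (r w)).symm)

/-- The identification: p1's `weilLine 4 V` (the annihilator of the relations among fourth powers) is
the range of the Weil projector `p_W = Q([x]^*)`, i.e. the descended Weil line `W₀` (Lemma A1.3 /
Prop. A2.3(iv)). -/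
theorem weilLine_eq_range (hn : Module.finrank F V = 4) (x : F) (Q : ℚ[X])
    (hp : IsIdempotentElem (aeval (T F V 4 x) Q))
    (hW : Submodule.baseChange F (LinearMap.range (aeval (T F V 4 x) Q)) =
      A1SplitSummandDescent.eigenSummandK ℚ F F V 4 b) :
    weilLine (K := F) 4 V = LinearMap.range (aeval (T F V 4 x) Q) := by
  have hQ1 := aeval_pow_eq_one F V b hn x Q hp hW
  obtain ⟨W₁, hW₁, hbij⟩ := A1DescendedBijection.exists_descended_bijective ℚ F F V 4 b
    (A1GaloisTensorSplitting.card_algHom_self ℚ F)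
  have hWW : W₁ = LinearMap.range (aeval (T F V 4 x) Q) :=
    A1BaseChange.baseChange_injective (K := F) (hW₁.trans hW.symm)
  set r := A1DescendedSurjection.restrictMap ℚ F V 4 with hr
  have hinj : ∀ u u' : ⋀[ℚ]^4 V, u ∈ W₁ → u' ∈ W₁ → r u = r u' → u = u' := by
    intro u u' hu hu' h
    have : (r ∘ₗ W₁.subtype) ⟨u, hu⟩ = (r ∘ₗ W₁.subtype) ⟨u', hu'⟩ := by simpa using h
    exact congrArg Subtype.val (hbij.1 this)
  apply le_antisymm
  · -- ⊆: the relation Q(x⁴) − 1 = 0 among fourth powers forces p_W w = w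
    intro w hw
    simp only [weilLine, Submodule.mem_iInf] at hw
    set c : F →₀ ℚ :=
      (∑ j ∈ Finset.range (Q.natDegree + 1), Finsupp.single (x ^ j) (Q.coeff j)) - Finsupp.single 1 1
      with hc
    have hrel : (c.sum fun a q => q • a ^ 4) = 0 := by
      rw [hc, sum_relation F x Q (fun a => a ^ 4)]
      have := Polynomial.aeval_eq_sum_range (R := ℚ) (p := Q) (x ^ 4)
      rw [hQ1] at this
      rw [sub_eq_zero, one_pow, this]
      refine Finset.sum_congr rfl fun j _ => ?_
      rw [pow_right_comm]
    have hker := hw c hrel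
    rw [LinearMap.mem_ker] at hker
    have hT : (c.sum fun a q => q • exteriorPower.map 4 ((LinearMap.lsmul F V a).restrictScalars ℚ)) =
        aeval (T F V 4 x) Q - 1 := by
      change (c.sum fun a q => q • T F V 4 a) = _
      rw [hc, sum_relation F x Q (fun a => T F V 4 a), T_one, Polynomial.aeval_eq_sum_range]
      refine congrArg (· - 1) (Finset.sum_congr rfl fun j _ => ?_)
      rw [T_pow]
    rw [hT, LinearMap.sub_apply, Module.End.one_apply, sub_eq_zero] at hker
    exact ⟨w, hker⟩
  · -- ⊇: on W₀ every [a]^* acts as a⁴ • through r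
    rw [← hWW]
    intro w hw
    simp only [weilLine, Submodule.mem_iInf]
    intro c hc
    rw [LinearMap.mem_ker]
    have hmem : (c.sum fun a q => q • exteriorPower.map 4 ((LinearMap.lsmul F V a).restrictScalars ℚ)) w ∈ W₁ := by
      change (c.sum fun a q => q • T F V 4 a) w ∈ W₁
      rw [Finsupp.sum, LinearMap.sum_apply]
      refine Submodule.sum_mem _ fun a _ => ?_
      rw [LinearMap.smul_apply]
      refine Submodule.smul_mem _ _ ?_
      rw [hWW] at hw ⊢
      exact T_mem_range_aeval F V 4 a x Q hw
    refine hinj _ 0 hmem (zero_mem _) ?_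
    change r ((c.sum fun a q => q • T F V 4 a) w) = r 0
    rw [map_zero, Finsupp.sum, LinearMap.sum_apply, map_sum]
    have : ∀ a ∈ c.support, r ((c a • T F V 4 a) w) = (c a • a ^ 4) • r w := by
      intro a _
      rw [LinearMap.smul_apply, map_smul, restrictMap_T, smul_assoc]
    rw [Finset.sum_congr rfl this, ← Finset.sum_smul]
    have hc' : (∑ a ∈ c.support, c a • a ^ 4) = 0 := by
      rw [← hc]
      rfl
    rw [hc', zero_smul]

omit b in
/-- LINE-HIT for p1's `weilLine` (the interface's `weilQ`): a `[x]^*`-stable subspace meeting the Weil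
line non-trivially contains it (Lemma A3.1 + Prop. A3.2). -/
theorem weilLine_le_of_inf_ne_bot (hn : Module.finrank F V = 4)
    (A : Submodule ℚ (⋀[ℚ]^4 V)) (hA : ∀ x : F, ∀ v ∈ A, T F V 4 x v ∈ A)
    (hne : A ⊓ weilLine (K := F) 4 V ≠ ⊥) : weilLine (K := F) 4 V ≤ A := by
  classical
  haveI : FiniteDimensional ℚ V := Module.Finite.trans F V
  let b := Module.finBasis ℚ V
  obtain ⟨x, Q, hp, hW, -⟩ := exists_weilProjector F V 4 b
  have heq := weilLine_eq_range F V b hn x Q hp hW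
  rw [heq] at hne ⊢
  exact weil_le_of_inf_ne_bot F V b hn _ hW (fun a w hw => T_mem_range_aeval F V 4 a x Q hw) A hA hne

end numberField

end Summit.Ventures.HodgeRepro2.T6.A1WeilLine
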